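import Summits.QuantumFields.BalabanUV.Beta.GAN24.WoodburyFibreZeroModeGainKInv

/-!
# GAN24 / WoodburyFibreZeroModeGainStep — the zero-mode gain on the DECIMATED one-step resolvent `KInvStep Lc j` (an2's
# `OneStepKernelFamily`): its field–field block has zero `Lc`-contour sums on the step-`j` lattice on BOTH legs, for EVERY `j`;
# hence the one- and two-sided gains with references at the FIXED scale `Lc` (the `j`-independent block side of the W-slot's terms)
# (census row V14 of `HOME/b2b-balaban-gan24-p3/WOODBURY-FIBRE.md` v8; binder row G-an2-4 ∕ (CONV-C), P3, gen 8)

Cell `pub-balaban`, β sub-cell.  HONEST FRAMING (verbatim): discharging `BetaPertH` makes Bałaban's UV stability UNCONDITIONAL — a real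
constructive-QFT result; it is NOT the continuum limit and NOT the Clay problem.  HONEST DEPENDENCY (verbatim): continuum YM on T⁴ ⇐
BetaPertH ∧ nine spine estimates (0/9 proved); BetaPertH ⇐ (D1) ∧ (D4) ∧ CAP+tail; G-an2-4 gates asym, D1 and NE2/3/4.  NOT IN PRINT; OUR
BOOKKEEPING.  [folklore] over an2's `OneStepKernelFamily.KInvStep` ∕ `dec` ∕ `shiftK_KInvStep`, an2∕pv's `StepDriftWitness.contourSum_compose`
∕ `sum_LegIdx_eq_contourSum` («`Q_L` composed with `Q_M` is `Q_{ML}`») and `KKTFluctuationKernel.Gam_Q` BY NAME; cites nothing, mints no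
`def … : Prop`, instantiates no wall binder; every `Decays` bound of the block is a HYPOTHESIS.  Discharges NOTHING of (CONV-C), the W-slot,
«T2Shape», (D1); NEVER «G-an2-4 closed»; NOT BetaPertH, NOT continuum, NOT Clay.

## Contents (all [folklore]; `Γ_j^{ff} := blockFF (KInvStep Lc j)`, contours of the FIXED side `Lc` on the step-`j` lattice)
* `blockFF_dec` (`blockFF ∘ dec M = dec M ∘ blockFF`), `dec_inl_eq_sum_contourSum` (a field row of `dec M K` is `M^{−(d+2)}·legW·Σ_{i′}` of
  `M`-contour sums of the corresponding rows of `K`), `sum_box_range_dec_inl` (summing it over the `Lc`-contour at the origin gives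
  `(M·Lc)`-contour sums of `K` — `contourSum_compose`);
* **`contourSum_blockFF_KInvStep_left`**: `contourSum Lc (fun κ′ x′ => Γ_j^{ff} x′ y′ (inl κ′) b) κ u = 0` for every `j`, `u` (block covariance
  `shiftK_KInvStep` + the origin case + `Gam_Q` at blocking `Lc^(j+1)`); `KInvStep_inl_inl_symm` (symmetry of the field block survives the
  decimation) and **`contourSum_blockFF_KInvStep_right`**;
* **`decays_comp_ffKInvStep_right`** ∕ **`decays_comp_ffKInvStep_left`** ∕ **`decays_comp_comp_ffKInvStep`**: the gains of
  `WoodburyFibreZeroModeGain` for `Γ_j^{ff}` with the references `contourRef Lc` ∕ `contourRefL Lc`; combined with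
  `WoodburyFibreZeroModeOsc.decays_sub_contourRef(L)` the input is a forward-difference bound `ε` on the leg and the constant is
  `∝ (d+2)(Lc−1)·ε` — `j`-INDEPENDENT bookkeeping (the `Decays` data of `Γ_j^{ff}` and of the legs are whatever the consumer supplies).
-/

noncomputable section

open Finset
open scoped BigOperators
open Literature.MathematicalPhysics.QuantumFieldTheory
open Literature.MathematicalPhysics.QuantumFieldTheory.Balaban1983to89
open Literature.MathematicalPhysics.QuantumFieldTheory.Balaban1983to89.Beta
open B12Sec2to5 (l1 l1_nonneg)
open ExpKernelCalculus (MKer Decays comp Zl shiftK)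
open KernelWard (Bdd bdd_of_decays)
open Summit.QuantumFields.BalabanUV.Beta.TameKernelCalculus (Spr)
open AffineAveraging (contourSum unitVec toSite box Form1)
open LatticeForm (quo)
open OneStepResolventKernel (Fib KInv KInv_inl_inl KInv_inl_inl_symm)
open OneStepKernelFamily (LegIdx legSet legPt legW dec KInvStep shiftK_KInvStep)
open StepDriftWitness (contourSum_compose sum_LegIdx_eq_contourSum)
open KKTFluctuationKernel (Gam Gam_Q)
open Summit.QuantumFields.BalabanUV.Beta.GAN24.WoodburyFibreBlocks (blockFF)
open Summit.QuantumFields.BalabanUV.Beta.GAN24.WoodburyFibreZeroModeGain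
open Summit.QuantumFields.BalabanUV.Beta.GAN24.WoodburyFibreZeroModeGainKInv

namespace Summit.QuantumFields.BalabanUV.Beta.GAN24.WoodburyFibreZeroModeGainStep

variable {d : ℕ}

/-! ## §1 Decimation bookkeeping for the field rows -/

/-- `blockFF` commutes with the decimation. [folklore] -/
theorem blockFF_dec (M : ℕ) (K : MKer (d + 1) (Fib d)) : blockFF (dec M K) = dec M (blockFF K) := by
  funext x y a b
  rcases a with κ | κ <;> rcases b with l | l <;> simp [blockFF, dec]

/-- A field row of `dec M K`, read as a sum of `M`-contour sums of the corresponding field rows of `K`. [folklore] -/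
theorem dec_inl_eq_sum_contourSum (M : ℕ) (K : MKer (d + 1) (Fib d)) (κ : Fin (d + 1)) (b : Fib d) (x' y' : Fin (d + 1) → ℤ) :
    dec M K x' y' (Sum.inl κ) b
      = ((M : ℝ) ^ (d + 2))⁻¹ * legW d M b *
          ∑ i' ∈ legSet d M b, contourSum M (fun κ' z => K z (legPt M b y' i') (Sum.inl κ') b) κ x' := by
  simp only [dec, legSet, legW, Finset.mul_sum]
  rw [Finset.sum_comm]
  refine Finset.sum_congr rfl fun i' _ => ?_
  rw [← sum_LegIdx_eq_contourSum M κ (fun κ' z => K z (legPt M b y' i') (Sum.inl κ') b) x', Finset.mul_sum]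

/-- Summing a field row of `dec M K` over the `Lc`-contour at the origin gives `(M·Lc)`-contour sums of the rows of `K`. [folklore] -/
theorem sum_box_range_dec_inl {M : ℕ} (hM : 0 < M) (Lc : ℕ) (K : MKer (d + 1) (Fib d)) (κ : Fin (d + 1)) (b : Fib d)
    (y' : Fin (d + 1) → ℤ) :
    ∑ b' ∈ box (d + 1) Lc, ∑ s' ∈ Finset.range Lc, dec M K (toSite b' + (s' : ℤ) • unitVec κ) y' (Sum.inl κ) b
      = ((M : ℝ) ^ (d + 2))⁻¹ * legW d M b *
          ∑ i' ∈ legSet d M b, contourSum (M * Lc) (fun κ' z => K z (legPt M b y' i') (Sum.inl κ') b) κ 0 := by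
  simp only [dec_inl_eq_sum_contourSum, ← Finset.mul_sum]
  congr 1
  rw [Finset.sum_congr rfl (fun b' _ => Finset.sum_comm), Finset.sum_comm]
  -- now: Σ_{i'} Σ_{b'} Σ_{s'} contourSum M (…) κ (toSite b' + s' e_κ) = Σ_{i'} contourSum (M Lc) (…) κ 0
  refine Finset.sum_congr rfl fun i' _ => ?_
  exact contourSum_compose M Lc hM _ κ

/-! ## §2 Zero contour sums of the field–field block of `KInvStep Lc j`, both legs -/

section Step

variable {Lc : ℕ} [NeZero Lc]

/-- **LEFT ZERO MODES of `Γ_j^{ff}`** at the origin block. [folklore] -/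
theorem sum_box_range_blockFF_KInvStep (j : ℕ) (κ : Fin (d + 1)) (b : Fib d) (y' : Fin (d + 1) → ℤ) :
    ∑ b' ∈ box (d + 1) Lc, ∑ s' ∈ Finset.range Lc,
        blockFF (KInvStep (d := d) Lc j) (toSite b' + (s' : ℤ) • unitVec κ) y' (Sum.inl κ) b = 0 := by
  have hM : 0 < Lc ^ j := pow_pos (Nat.pos_of_ne_zero (NeZero.ne Lc)) j
  unfold KInvStep
  rw [blockFF_dec, sum_box_range_dec_inl hM]
  have hz : ∀ i' ∈ legSet d (Lc ^ j) b,
      contourSum (Lc ^ j * Lc) (fun κ' z => blockFF (KInv (N := Lc ^ (j + 1)) (d := d)) z (legPt (Lc ^ j) b y' i') (Sum.inl κ') b) κ 0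
        = 0 := by
    intro i' _
    rw [← pow_succ]
    exact contourSum_blockFF_KInv_left (N := Lc ^ (j + 1)) _ b κ 0
  rw [Finset.sum_eq_zero hz, mul_zero]

/-- **LEFT ZERO MODES of `Γ_j^{ff}`**: every field column of `blockFF (KInvStep Lc j)` has zero `Lc`-contour sums in its first variable, at
every coarse point `u` (block covariance `shiftK_KInvStep` reduces to the origin). [folklore] -/
theorem contourSum_blockFF_KInvStep_left (j : ℕ) (y' : Fin (d + 1) → ℤ) (b : Fib d) (κ : Fin (d + 1)) (u : Fin (d + 1) → ℤ) :
    contourSum Lc (fun κ' x' => blockFF (KInvStep (d := d) Lc j) x' y' (Sum.inl κ') b) κ u = 0 := by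
  have hcov : ∀ x' : Fin (d + 1) → ℤ, blockFF (KInvStep (d := d) Lc j) ((Lc : ℤ) • u + x') y' (Sum.inl κ) b
      = blockFF (KInvStep (d := d) Lc j) x' (y' - (Lc : ℤ) • u) (Sum.inl κ) b := by
    intro x'
    cases b with
    | inl l =>
        simp only [blockFF]
        have h' := congrFun (congrFun (congrFun (congrFun (shiftK_KInvStep (d := d) (Lc := Lc) j u) ((Lc : ℤ) • u + x'))
          y') (Sum.inl κ)) (Sum.inl l)
        simp only [shiftK] at h'
        have e1 : (Lc : ℤ) • u + x' + -((Lc : ℤ) • u) = x' := by abel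
        have e2 : y' + -((Lc : ℤ) • u) = y' - (Lc : ℤ) • u := by abel
        rw [e1, e2] at h'
        exact h'.symm
    | inr l => simp only [blockFF]
  simp only [contourSum]
  have e : ∀ b' ∈ box (d + 1) Lc, ∀ s' ∈ Finset.range Lc,
      blockFF (KInvStep (d := d) Lc j) ((Lc : ℤ) • u + toSite b' + (s' : ℤ) • unitVec κ) y' (Sum.inl κ) b
        = blockFF (KInvStep (d := d) Lc j) (toSite b' + (s' : ℤ) • unitVec κ) (y' - (Lc : ℤ) • u) (Sum.inl κ) b := by
    intro b' _ s' _
    rw [add_assoc, hcov]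
  rw [Finset.sum_congr rfl fun b' hb' => Finset.sum_congr rfl fun s' hs' => e b' hb' s' hs']
  exact sum_box_range_blockFF_KInvStep j κ b _

/-- SYMMETRY of the field–field block survives the decimation. [folklore] -/
theorem KInvStep_inl_inl_symm (j : ℕ) (κ l : Fin (d + 1)) (x y : Fin (d + 1) → ℤ) :
    KInvStep (d := d) Lc j x y (Sum.inl κ) (Sum.inl l) = KInvStep (d := d) Lc j y x (Sum.inl l) (Sum.inl κ) := by
  unfold KInvStep
  simp only [dec, legSet, legW]
  rw [Finset.sum_comm]
  refine Finset.sum_congr rfl fun i _ => Finset.sum_congr rfl fun i' _ => ?_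
  rw [KInv_inl_inl_symm]

/-- **RIGHT ZERO MODES of `Γ_j^{ff}`**: every field row of `blockFF (KInvStep Lc j)` has zero `Lc`-contour sums in its second variable. [folklore] -/
theorem contourSum_blockFF_KInvStep_right (j : ℕ) (x : Fin (d + 1) → ℤ) (a : Fib d) (κ : Fin (d + 1)) (u : Fin (d + 1) → ℤ) :
    contourSum Lc (fun κ' y => blockFF (KInvStep (d := d) Lc j) x y a (Sum.inl κ')) κ u = 0 := by
  cases a with
  | inl l =>
      have e : (fun κ' y => blockFF (KInvStep (d := d) Lc j) x y (Sum.inl l) (Sum.inl κ'))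
          = fun κ' y => blockFF (KInvStep (d := d) Lc j) y x (Sum.inl κ') (Sum.inl l) := by
        funext κ' y
        simp only [blockFF, KInvStep_inl_inl_symm j l κ' x y]
      rw [e]
      exact contourSum_blockFF_KInvStep_left j x (Sum.inl l) κ u
  | inr l =>
      simp only [blockFF, contourSum, Finset.sum_const_zero]

/-! ## §3 The gains for `Γ_j^{ff}` with references at the fixed scale `Lc` -/

/-- **ONE-SIDED GAIN FOR `Γ_j^{ff}` (right leg)**, references `contourRef Lc`. [folklore] -/
theorem decays_comp_ffKInvStep_right (j : ℕ) {J : MKer (d + 1) (Fib d)} {CΓ ω δ δ' B : ℝ}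
    (hΓ : Decays (blockFF (KInvStep (d := d) Lc j)) CΓ δ) (hδ : 0 < δ) (hJ : Bdd J B) (hω : Decays (J - contourRef Lc J) ω δ)
    (hδ'0 : 0 ≤ δ') (hδ' : δ' < δ) :
    Decays (comp (blockFF (KInvStep (d := d) Lc j)) J) ((Fintype.card (Fib d) : ℝ) * (CΓ * ω) * Zl (d + 1) (δ - δ')) δ' :=
  decays_comp_of_contourSum_eq_zero hΓ hδ hJ (fun x y a κ => blockFF_inr_right _ x y a κ)
    (fun x a κ u => contourSum_blockFF_KInvStep_right j x a κ u) hω hδ'0 hδ'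

/-- **ONE-SIDED GAIN FOR `Γ_j^{ff}` (left leg)**, references `contourRefL Lc`. [folklore] -/
theorem decays_comp_ffKInvStep_left (j : ℕ) {A : MKer (d + 1) (Fib d)} {CΓ ω δ δ' B : ℝ} (hA : Bdd A B)
    (hΓ : Decays (blockFF (KInvStep (d := d) Lc j)) CΓ δ) (hδ : 0 < δ) (hω : Decays (A - contourRefL Lc A) ω δ)
    (hδ'0 : 0 ≤ δ') (hδ' : δ' < δ) :
    Decays (comp A (blockFF (KInvStep (d := d) Lc j))) ((Fintype.card (Fib d) : ℝ) * (ω * CΓ) * Zl (d + 1) (δ - δ')) δ' :=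
  decays_comp_of_contourSum_eq_zero_left hA hΓ hδ (fun y z κ b => blockFF_inr_left _ y z κ b)
    (fun z b κ u => contourSum_blockFF_KInvStep_left j z b κ u) hω hδ'0 hδ'

/-- **TWO-SIDED GAIN FOR `Γ_j^{ff}`**: both oscillations (over the `Lc`-contours of the step-`j` lattice) are gained. [folklore] -/
theorem decays_comp_comp_ffKInvStep (j : ℕ) {A B : MKer (d + 1) (Fib d)} {CA CΓ CB ωA ωB δ δ' δ'' : ℝ} (hA : Decays A CA δ)
    (hΓ : Decays (blockFF (KInvStep (d := d) Lc j)) CΓ δ) (hB : Decays B CB δ) (hCB : 0 ≤ CB) (hδ : 0 < δ)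
    (hωA : Decays (A - contourRefL Lc A) ωA δ) (hωB : Decays (B - contourRef Lc B) ωB δ) (hωB0 : 0 ≤ ωB)
    (hδ'0 : 0 < δ') (hδ' : δ' < δ) (hδ''0 : 0 ≤ δ'') (hδ'' : δ'' < δ') :
    Decays (comp (comp A (blockFF (KInvStep (d := d) Lc j))) B)
      ((Fintype.card (Fib d) : ℝ) * (((Fintype.card (Fib d) : ℝ) * (ωA * CΓ) * Zl (d + 1) (δ - δ')) * ωB) *
        Zl (d + 1) (δ' - δ'')) δ'' := by
  have hΓs : Spr (blockFF (KInvStep (d := d) Lc j)) := ⟨CΓ, δ, hδ, hΓ⟩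
  have hAb : Bdd A CA := bdd_of_decays hA hδ.le
  have hBb : Bdd B CB := bdd_of_decays hB hδ.le
  refine decays_comp_comp_of_annihil hAb (bdd_contourRefL hAb) hΓ hδ hBb
    ⟨_, δ, hδ, decays_contourRef (N := Lc) hB hCB hδ.le⟩ ?_ ?_ hωA hωB hωB0 hδ'0 hδ' hδ''0 hδ''
  · exact comp_contourRefL_eq_zero hAb hΓs.tame.2.1 (fun y z κ b => blockFF_inr_left _ y z κ b)
      (fun z b κ u => contourSum_blockFF_KInvStep_left j z b κ u)
  · exact comp_contourRef_eq_zero hΓs.tame.1 hBb (fun x y a κ => blockFF_inr_right _ x y a κ)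
      (fun x a κ u => contourSum_blockFF_KInvStep_right j x a κ u)

end Step

end Summit.QuantumFields.BalabanUV.Beta.GAN24.WoodburyFibreZeroModeGainStep

end
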